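import Mathlib.Analysis.SpecialFunctions.Pow.Real
import Literature.Combinatorics.Additive.TricoloredSumFreeLowerBoundCoupling
import HarnessLib

/-!
# Compatible triples of distributions with constant sum (Pebody 2018), II: the peeling step

Second support file for Pebody's Theorem 4 (see `TricoloredSumFreeLowerBoundCoupling.lean` for
the setting). In cone form an *`m`-profile* is a nonnegative non-increasing `π : ℕ → ℝ` vanishing
above `m` (`IsProfile`), and a triple is *admissible at level `m`* (`Admissible`) if the three
profiles have equal mass `Σ_{k≤m} π k` and their first moments add up to `m` times the mass
(Pebody: "decreasing distributions on `[p]` with expected values summing to `p - 1`").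

* `two_mul_sum_Ico_mul_le` — the midpoint (Chebyshev) inequality for non-increasing weights;
* `apply_zero_le_tail_add_tail` — **Lemma 7**: `π₁(0) ≤ P(π₂ > t) + P(π₃ ≥ M - t)`;
* `apply_zero_le_sum_min`, `exists_peel` — the weights `f(k) = min(π₂ k, π₃(M-k), x)` of the
  proof of **Corollary 8** (`x` by the intermediate value theorem), with `Σ f = π₁(0)` and
  non-increasing residuals;
* `coupled_of_top_eq_zero` — **Corollary 8**: if every admissible triple at level `m` is
  compatible, so is every admissible triple at level `m + 1` whose second and third profiles
  vanish at `m + 1` (peel the atoms `(0, k, m+1-k)` with weights `f k`, shift, recurse).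

## References

* [Peabody2018] L. Pebody, *Proof of a conjecture of Kleinberg–Sawin–Speyer*, Discrete Analysis
  2018:13, arXiv:1608.05740 — §3 Lemma 7, Corollary 8.
-/

noncomputable section

open Finset

open scoped BigOperators

namespace Literature.Combinatorics.Additive.Pebody

/-- An `m`-profile: a nonnegative, non-increasing function on `ℕ` vanishing above `m`
(an unnormalised "decreasing distribution on `[p]`", `p = m + 1`). [cite: Peabody2018, §1] -/
def IsProfile (m : ℕ) (π : ℕ → ℝ) : Prop :=
  (∀ k, 0 ≤ π k) ∧ (∀ k, π (k + 1) ≤ π k) ∧ (∀ k, m < k → π k = 0)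

/-- Total mass `Σ_{k ≤ m} π k`. [folklore] -/
def mass (m : ℕ) (π : ℕ → ℝ) : ℝ := ∑ k ∈ range (m + 1), π k

/-- First moment `Σ_{k ≤ m} k π k`. [folklore] -/
def moment (m : ℕ) (π : ℕ → ℝ) : ℝ := ∑ k ∈ range (m + 1), (k : ℝ) * π k

/-- An admissible triple at level `m`: three `m`-profiles of equal mass whose first moments add
up to `m` times the mass (Pebody's hypothesis "decreasing distributions on `[p]` with expected
values summing to `p - 1`", in cone form). [cite: Peabody2018, Theorem 4] -/
def Admissible (m : ℕ) (π₁ π₂ π₃ : ℕ → ℝ) : Prop :=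
  IsProfile m π₁ ∧ IsProfile m π₂ ∧ IsProfile m π₃ ∧ mass m π₁ = mass m π₂ ∧
    mass m π₂ = mass m π₃ ∧ moment m π₁ + moment m π₂ + moment m π₃ = m * mass m π₁

/-- Profiles are nonnegative. [folklore] -/
theorem IsProfile.nonneg {m : ℕ} {π : ℕ → ℝ} (h : IsProfile m π) (k : ℕ) : 0 ≤ π k := h.1 k

/-- Profiles are non-increasing. [folklore] -/
theorem IsProfile.antitone {m : ℕ} {π : ℕ → ℝ} (h : IsProfile m π) : Antitone π :=
  antitone_nat_of_succ_le h.2.1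

/-- Profiles vanish above the level. [folklore] -/
theorem IsProfile.eq_zero {m : ℕ} {π : ℕ → ℝ} (h : IsProfile m π) {k : ℕ} (hk : m < k) :
    π k = 0 := h.2.2 k hk

/-- The value at `0` is at most the mass. [folklore] -/
theorem IsProfile.apply_zero_le_mass {m : ℕ} {π : ℕ → ℝ} (h : IsProfile m π) : π 0 ≤ mass m π := by
  unfold mass
  rw [Finset.sum_range_succ']
  have : 0 ≤ ∑ k ∈ range m, π (k + 1) := Finset.sum_nonneg fun k _ => h.nonneg _
  linarith

/-- Chebyshev's midpoint inequality: for a non-increasing `π`, the `π`-weighted mean of `k` over an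
interval `[u,v)` is at most the midpoint `(u+v-1)/2`. [folklore] -/
theorem two_mul_sum_Ico_mul_le {π : ℕ → ℝ} (hπ : Antitone π) {u v : ℕ} (huv : u ≤ v) :
    2 * ∑ k ∈ Ico u v, (k : ℝ) * π k ≤ ((u : ℝ) + v - 1) * ∑ k ∈ Ico u v, π k := by
  induction v, huv using Nat.le_induction with
  | base => simp
  | succ v huv ih =>
    rw [Finset.sum_Ico_succ_top huv, Finset.sum_Ico_succ_top huv]
    have hS : (v - u : ℕ) * π v ≤ ∑ k ∈ Ico u v, π k := by
      have : ∑ k ∈ Ico u v, π v ≤ ∑ k ∈ Ico u v, π k :=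
        Finset.sum_le_sum fun k hk => hπ (Finset.mem_Ico.1 hk).2.le
      simpa using this
    have hvu : ((v - u : ℕ) : ℝ) = v - u := by rw [Nat.cast_sub huv]
    rw [hvu] at hS
    push_cast
    nlinarith [ih, hS]

/-- **Pebody's Lemma 7** (cone form): for an admissible triple at level `M` and `t ≤ M`,
`π₁(0) ≤ Σ_{t<k≤M} π₂(k) + Σ_{M-t≤k≤M} π₃(k)`. [cite: Peabody2018, Lemma 7] -/
theorem apply_zero_le_tail_add_tail {M : ℕ} {π₁ π₂ π₃ : ℕ → ℝ} (h : Admissible M π₁ π₂ π₃)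
    {t : ℕ} (ht : t ≤ M) :
    π₁ 0 ≤ ∑ k ∈ Ico (t + 1) (M + 1), π₂ k + ∑ k ∈ Ico (M - t) (M + 1), π₃ k := by
  obtain ⟨h1, h2, h3, hm12, hm23, hmom⟩ := h
  -- moment bounds
  have b1 : 2 * moment M π₁ ≤ ((M : ℝ) + 1) * (mass M π₁ - π₁ 0) := by
    have e1 : moment M π₁ = ∑ k ∈ Ico 1 (M + 1), (k : ℝ) * π₁ k := by
      unfold moment
      rw [Finset.range_eq_Ico, Finset.sum_eq_sum_Ico_succ_bot (by omega)]
      simp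
    have e2 : mass M π₁ - π₁ 0 = ∑ k ∈ Ico 1 (M + 1), π₁ k := by
      unfold mass
      rw [Finset.range_eq_Ico, Finset.sum_eq_sum_Ico_succ_bot (by omega)]
      ring
    rw [e1, e2]
    have := two_mul_sum_Ico_mul_le h1.antitone (show 1 ≤ M + 1 by omega)
    push_cast at this
    linarith
  have split : ∀ (π : ℕ → ℝ) (s : ℕ), s ≤ M + 1 →
      (∑ k ∈ range (M + 1), π k = ∑ k ∈ Ico 0 s, π k + ∑ k ∈ Ico s (M + 1), π k) := by
    intro π s hs
    rw [Finset.range_eq_Ico, Finset.sum_Ico_consecutive _ (Nat.zero_le s) hs]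
  have b2 : 2 * moment M π₂ ≤ (t : ℝ) * ∑ k ∈ Ico 0 (t + 1), π₂ k +
      ((t : ℝ) + 1 + (M + 1) - 1) * ∑ k ∈ Ico (t + 1) (M + 1), π₂ k := by
    unfold moment
    rw [split _ (t + 1) (by omega), mul_add]
    have i1 := two_mul_sum_Ico_mul_le h2.antitone (Nat.zero_le (t + 1))
    have i2 := two_mul_sum_Ico_mul_le h2.antitone (show t + 1 ≤ M + 1 by omega)
    push_cast at i1 i2
    nlinarith [i1, i2]
  have b3 : 2 * moment M π₃ ≤ ((M - t : ℕ) - 1 : ℝ) * ∑ k ∈ Ico 0 (M - t), π₃ k +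
      (((M - t : ℕ) : ℝ) + (M + 1) - 1) * ∑ k ∈ Ico (M - t) (M + 1), π₃ k := by
    unfold moment
    rw [split _ (M - t) (by omega), mul_add]
    have i1 := two_mul_sum_Ico_mul_le h3.antitone (Nat.zero_le (M - t))
    have i2 := two_mul_sum_Ico_mul_le h3.antitone (show M - t ≤ M + 1 by omega)
    push_cast at i1 i2
    nlinarith [i1, i2]
  have m2 : mass M π₂ = ∑ k ∈ Ico 0 (t + 1), π₂ k + ∑ k ∈ Ico (t + 1) (M + 1), π₂ k :=
    split _ _ (by omega)
  have m3 : mass M π₃ = ∑ k ∈ Ico 0 (M - t), π₃ k + ∑ k ∈ Ico (M - t) (M + 1), π₃ k :=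
    split _ _ (by omega)
  have hMt : ((M - t : ℕ) : ℝ) = M - t := by rw [Nat.cast_sub ht]
  rw [hMt] at b3
  have hB2 : 0 ≤ ∑ k ∈ Ico 0 (t + 1), π₂ k := Finset.sum_nonneg fun k _ => h2.nonneg k
  have hB3 : 0 ≤ ∑ k ∈ Ico 0 (M - t), π₃ k := Finset.sum_nonneg fun k _ => h3.nonneg k
  have hM : (0 : ℝ) < M + 1 := by positivity
  nlinarith [b1, b2, b3, m2, m3, hm12, hm23, hmom, hB2, hB3]

/-- The sum of the pointwise minima `min(π₂ k, π₃(M-k))` dominates `π₁(0)` (Pebody, proof of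
Corollary 8: the set where `π₂(k) > π₃(M-k)` is an initial segment `[0,t]`, then Lemma 7).
[cite: Peabody2018, Corollary 8] -/
theorem apply_zero_le_sum_min {M : ℕ} {π₁ π₂ π₃ : ℕ → ℝ} (h : Admissible M π₁ π₂ π₃) :
    π₁ 0 ≤ ∑ k ∈ range (M + 1), min (π₂ k) (π₃ (M - k)) := by
  have h1 := h.1; have h2 := h.2.1; have h3 := h.2.2.1
  classical
  set P : Finset ℕ := (range (M + 1)).filter fun k => π₃ (M - k) < π₂ k with hP
  by_cases hPe : P = ∅
  · -- every minimum is `π₂ k`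
    have : ∀ k ∈ range (M + 1), min (π₂ k) (π₃ (M - k)) = π₂ k := by
      intro k hk
      have : k ∉ P := by rw [hPe]; simp
      rw [hP, Finset.mem_filter, not_and] at this
      exact min_eq_left (not_lt.1 (this hk))
    rw [Finset.sum_congr rfl this]
    calc π₁ 0 ≤ mass M π₁ := h1.apply_zero_le_mass
      _ = mass M π₂ := h.2.2.2.1
  · have hPne : P.Nonempty := Finset.nonempty_iff_ne_empty.2 hPe
    set t := P.max' hPne with ht
    have htP : t ∈ P := Finset.max'_mem P hPne
    have htM : t ≤ M := by
      have := (Finset.mem_filter.1 htP).1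
      rw [Finset.mem_range] at this; omega
    -- `k ∈ P ↔ k ≤ t` on `[0, M]`
    have hdown : ∀ k, k ≤ t → π₃ (M - k) < π₂ k := by
      intro k hk
      have h' := (Finset.mem_filter.1 htP).2
      calc π₃ (M - k) ≤ π₃ (M - t) := h3.antitone (by omega)
        _ < π₂ t := h'
        _ ≤ π₂ k := h2.antitone hk
    have hup : ∀ k, t < k → k ≤ M → π₂ k ≤ π₃ (M - k) := by
      intro k hk hkM
      by_contra hlt
      have hkP : k ∈ P := Finset.mem_filter.2 ⟨Finset.mem_range.2 (by omega), not_le.1 hlt⟩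
      exact absurd (Finset.le_max' P k hkP) (by rw [← ht]; omega)
    have key := apply_zero_le_tail_add_tail h htM
    rw [Finset.range_eq_Ico, ← Finset.sum_Ico_consecutive _ (Nat.zero_le (t + 1))
      (show t + 1 ≤ M + 1 by omega)]
    have e1 : ∑ k ∈ Ico 0 (t + 1), min (π₂ k) (π₃ (M - k)) = ∑ k ∈ Ico (M - t) (M + 1), π₃ k := by
      rw [← Finset.range_eq_Ico]
      have : ∀ k ∈ range (t + 1), min (π₂ k) (π₃ (M - k)) = π₃ (M - k) := by
        intro k hk
        rw [Finset.mem_range] at hk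
        exact min_eq_right (hdown k (by omega)).le
      rw [Finset.sum_congr rfl this]
      -- reflect
      have := Finset.sum_range_reflect (fun j => π₃ (M - t + j)) (t + 1)
      simp only [add_tsub_cancel_right] at this
      rw [Finset.sum_Ico_eq_sum_range, show M + 1 - (M - t) = t + 1 by omega, ← this]
      refine Finset.sum_congr rfl fun k hk => ?_
      rw [Finset.mem_range] at hk
      congr 1; omega
    have e2 : ∑ k ∈ Ico (t + 1) (M + 1), min (π₂ k) (π₃ (M - k)) =
        ∑ k ∈ Ico (t + 1) (M + 1), π₂ k := by
      refine Finset.sum_congr rfl fun k hk => ?_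
      rw [Finset.mem_Ico] at hk
      exact min_eq_left (hup k (by omega) (by omega))
    rw [e1, e2]
    linarith


/-- The peeling weights of Pebody's Corollary 8: `f(k) = min(π₂ k, π₃(M-k), x)` with `x` chosen
(intermediate value theorem) so that `Σ f = π₁(0)`; the residuals `π₂ - f` and
`k ↦ π₃ k - f(M-k)` are again non-increasing. [cite: Peabody2018, Corollary 8] -/
theorem exists_peel {M : ℕ} {π₁ π₂ π₃ : ℕ → ℝ} (h : Admissible M π₁ π₂ π₃) :
    ∃ f : ℕ → ℝ, (∀ k, 0 ≤ f k) ∧ (∀ k, f k ≤ π₂ k) ∧ (∀ k, f k ≤ π₃ (M - k)) ∧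
      (∑ k ∈ range (M + 1), f k = π₁ 0) ∧ (∀ k, π₂ (k + 1) - f (k + 1) ≤ π₂ k - f k) ∧
      (∀ k, π₃ (k + 1) - f (M - (k + 1)) ≤ π₃ k - f (M - k)) := by
  have h1 := h.1; have h2 := h.2.1; have h3 := h.2.2.1
  set q : ℕ → ℝ := fun k => min (π₂ k) (π₃ (M - k)) with hq
  have hq0 : ∀ k, 0 ≤ q k := fun k => le_min (h2.nonneg k) (h3.nonneg _)
  -- choice of `x`
  set g : ℝ → ℝ := fun x => ∑ k ∈ range (M + 1), min (q k) x with hg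
  have hgc : Continuous g := by
    refine continuous_finsetSum _ fun k _ => ?_
    exact continuous_const.min continuous_id
  set X : ℝ := ∑ k ∈ range (M + 1), q k with hX
  have hqX : ∀ k ∈ range (M + 1), q k ≤ X := fun k hk =>
    Finset.single_le_sum (fun k _ => hq0 k) hk
  have hg0 : g 0 = 0 := by
    rw [hg]
    exact Finset.sum_eq_zero fun k _ => min_eq_right (hq0 k)
  have hgX : g X = X := by
    rw [hg]
    exact Finset.sum_congr rfl fun k hk => min_eq_left (hqX k hk)
  have hX0 : 0 ≤ X := Finset.sum_nonneg fun k _ => hq0 k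
  have hπX : π₁ 0 ∈ Set.Icc (g 0) (g X) := by
    rw [hg0, hgX]
    exact ⟨h1.nonneg 0, apply_zero_le_sum_min h⟩
  obtain ⟨x, hx, hgx⟩ := intermediate_value_Icc hX0 hgc.continuousOn hπX
  have hx0 : 0 ≤ x := hx.1
  refine ⟨fun k => min (q k) x, fun k => le_min (hq0 k) hx0, fun k => ?_, fun k => ?_, hgx,
    fun k => ?_, fun k => ?_⟩
  · exact (min_le_left _ _).trans (min_le_left _ _)
  · exact (min_le_left _ _).trans (min_le_right _ _)
  · -- residual of `π₂` is non-increasing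
    dsimp only
    rcases le_or_gt (min (q k) x) (min (q (k + 1)) x) with hle | hlt
    · linarith [h2.2.1 k]
    · -- then `f (k+1) = π₂ (k+1)`
      have hfx : min (q (k + 1)) x < x := hlt.trans_le (min_le_right _ _)
      have hf3 : min (q (k + 1)) x < π₃ (M - (k + 1)) :=
        calc min (q (k + 1)) x < min (q k) x := hlt
          _ ≤ π₃ (M - k) := (min_le_left _ _).trans (min_le_right _ _)
          _ ≤ π₃ (M - (k + 1)) := h3.antitone (by omega)
      have hfeq : min (q (k + 1)) x = π₂ (k + 1) := by
        have hne : min (q (k + 1)) x = q (k + 1) := by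
          rcases min_choice (q (k + 1)) x with h' | h'
          · exact h'
          · exact absurd h' hfx.ne
        rw [hne] at hf3 ⊢
        rcases min_choice (π₂ (k + 1)) (π₃ (M - (k + 1))) with h' | h'
        · exact h'
        · exact absurd h' hf3.ne
      rw [hfeq, sub_self, sub_nonneg]
      exact (min_le_left _ _).trans (min_le_left _ _)
  · -- residual of `π₃` is non-increasing
    dsimp only
    rcases Nat.lt_or_ge k M with hkM | hkM
    · obtain ⟨k', hk'⟩ : ∃ k', M - (k + 1) = k' := ⟨_, rfl⟩
      have hk1 : M - k = k' + 1 := by omega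
      rw [hk', hk1]
      rcases le_or_gt (min (q (k' + 1)) x) (min (q k') x) with hle | hlt
      · linarith [h3.2.1 k]
      · have hfx : min (q k') x < x := hlt.trans_le (min_le_right _ _)
        have hf2 : min (q k') x < π₂ k' :=
          calc min (q k') x < min (q (k' + 1)) x := hlt
            _ ≤ π₂ (k' + 1) := (min_le_left _ _).trans (min_le_left _ _)
            _ ≤ π₂ k' := h2.2.1 k'
        have hfeq : min (q k') x = π₃ (M - k') := by
          have hne : min (q k') x = q k' := by
            rcases min_choice (q k') x with h' | h'
            · exact h'
            · exact absurd h' hfx.ne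
          rw [hne] at hf2 ⊢
          rcases min_choice (π₂ k') (π₃ (M - k')) with h' | h'
          · exact absurd h' hf2.ne
          · exact h'
        rw [hfeq, show M - k' = k + 1 by omega, sub_self, sub_nonneg]
        calc min (q (k' + 1)) x ≤ π₃ (M - (k' + 1)) := (min_le_left _ _).trans (min_le_right _ _)
          _ = π₃ k := by rw [show M - (k' + 1) = k by omega]
    · rw [show M - (k + 1) = 0 by omega, show M - k = 0 by omega]
      linarith [h3.2.1 k]

/-- **Pebody's Corollary 8** (the induction step, cone form): if all admissible triples at level
`m` are compatible, then so is every admissible triple `(π₁, π₂, π₃)` at level `m + 1` with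
`π₂(m+1) = π₃(m+1) = 0`: peel off the mass `π₁(0)` along the atoms `(0, k, m+1-k)` with the weights
of `exists_peel`, shift `π₁` down by one and recurse. [cite: Peabody2018, Corollary 8] -/
theorem coupled_of_top_eq_zero {m : ℕ}
    (IH : ∀ π₁ π₂ π₃ : ℕ → ℝ, Admissible m π₁ π₂ π₃ → Coupled m π₁ π₂ π₃)
    {π₁ π₂ π₃ : ℕ → ℝ} (h : Admissible (m + 1) π₁ π₂ π₃) (h2t : π₂ (m + 1) = 0)
    (h3t : π₃ (m + 1) = 0) : Coupled (m + 1) π₁ π₂ π₃ := by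
  obtain ⟨h1, h2, h3, hm12, hm23, hmom⟩ := h
  obtain ⟨f, hf0, hf2, hf3, hfs, hmono2, hmono3⟩ := exists_peel ⟨h1, h2, h3, hm12, hm23, hmom⟩
  -- `f` vanishes at `0` and above `m`
  have hf00 : f 0 = 0 := le_antisymm (by simpa [h3t] using hf3 0) (hf0 0)
  have hftop : ∀ k, m < k → f k = 0 := by
    intro k hk
    refine le_antisymm ?_ (hf0 k)
    rcases Nat.lt_or_ge (m + 1) k with hk' | hk'
    · simpa [h2.eq_zero hk'] using hf2 k
    · have : k = m + 1 := by omega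
      subst this; simpa [h2t] using hf2 (m + 1)
  -- the residual triple
  set ρ₁ : ℕ → ℝ := fun k => π₁ (k + 1) with hρ₁
  set ρ₂ : ℕ → ℝ := fun k => π₂ k - f k with hρ₂
  set ρ₃ : ℕ → ℝ := fun k => π₃ k - f (m + 1 - k) with hρ₃
  have hsumf : ∑ k ∈ range (m + 1), f k = π₁ 0 := by
    rw [← hfs, Finset.sum_range_succ f (m + 1), hftop (m + 1) (by omega), add_zero]
  have hsumf' : ∑ k ∈ range (m + 1), f (m + 1 - k) = π₁ 0 := by
    have := Finset.sum_range_reflect f (m + 1 + 1)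
    rw [hfs, Finset.sum_range_succ, show m + 1 + 1 - 1 - (m + 1) = 0 by omega, hf00,
      add_zero] at this
    rw [← this]
    refine Finset.sum_congr rfl fun k hk => ?_
    congr 1
  have hF : ∑ k ∈ range (m + 1), (k : ℝ) * f (m + 1 - k) =
      (m + 1 : ℝ) * π₁ 0 - ∑ k ∈ range (m + 1), (k : ℝ) * f k := by
    have e1 : ∑ k ∈ range (m + 1), (k : ℝ) * f (m + 1 - k) =
        ∑ k ∈ range (m + 2), (k : ℝ) * f (m + 1 - k) := by
      rw [Finset.sum_range_succ (fun k => (k : ℝ) * f (m + 1 - k)) (m + 1), Nat.sub_self, hf00,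
        mul_zero, add_zero]
    have e2 : ∑ k ∈ range (m + 1), (k : ℝ) * f k = ∑ k ∈ range (m + 2), (k : ℝ) * f k := by
      rw [Finset.sum_range_succ (fun k => (k : ℝ) * f k) (m + 1), hftop (m + 1) (by omega),
        mul_zero, add_zero]
    rw [e1, e2, ← hfs, Finset.mul_sum, ← Finset.sum_sub_distrib,
      ← Finset.sum_range_reflect (fun k => (k : ℝ) * f (m + 1 - k)) (m + 2)]
    refine Finset.sum_congr rfl fun k hk => ?_
    rw [Finset.mem_range] at hk
    rw [show m + 2 - 1 - k = m + 1 - k by omega, show m + 1 - (m + 1 - k) = k by omega,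
      Nat.cast_sub (show k ≤ m + 1 by omega)]
    push_cast; ring
  have hadm : Admissible m ρ₁ ρ₂ ρ₃ := by
    refine ⟨⟨fun k => h1.nonneg _, fun k => h1.2.1 _, fun k hk => h1.eq_zero (by omega)⟩,
      ⟨fun k => sub_nonneg.2 (hf2 k), hmono2, fun k hk => ?_⟩,
      ⟨fun k => sub_nonneg.2 ?_, hmono3, fun k hk => ?_⟩, ?_, ?_, ?_⟩
    · show π₂ k - f k = 0
      rw [hftop k hk, sub_zero]
      rcases Nat.lt_or_ge (m + 1) k with hk' | hk'
      · exact h2.eq_zero hk'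
      · rw [show k = m + 1 by omega]; exact h2t
    · rcases Nat.lt_or_ge (m + 1) k with hk' | hk'
      · rw [show m + 1 - k = 0 by omega, hf00]; exact h3.nonneg k
      · have := hf3 (m + 1 - k); rwa [show m + 1 - (m + 1 - k) = k by omega] at this
    · show π₃ k - f (m + 1 - k) = 0
      rw [show m + 1 - k = 0 by omega, hf00, sub_zero]
      rcases Nat.lt_or_ge (m + 1) k with hk' | hk'
      · exact h3.eq_zero hk'
      · rw [show k = m + 1 by omega]; exact h3t
    · -- masses 1 = 2
      show ∑ k ∈ range (m + 1), π₁ (k + 1) = ∑ k ∈ range (m + 1), (π₂ k - f k)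
      rw [Finset.sum_sub_distrib, hsumf]
      have e1 : mass (m + 1) π₁ = ∑ k ∈ range (m + 1), π₁ (k + 1) + π₁ 0 := by
        unfold mass; rw [Finset.sum_range_succ']
      have e2 : mass (m + 1) π₂ = ∑ k ∈ range (m + 1), π₂ k := by
        unfold mass; rw [Finset.sum_range_succ, h2t, add_zero]
      linarith
    · show ∑ k ∈ range (m + 1), (π₂ k - f k) = ∑ k ∈ range (m + 1), (π₃ k - f (m + 1 - k))
      rw [Finset.sum_sub_distrib, Finset.sum_sub_distrib, hsumf, hsumf']
      have e2 : mass (m + 1) π₂ = ∑ k ∈ range (m + 1), π₂ k := by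
        unfold mass; rw [Finset.sum_range_succ, h2t, add_zero]
      have e3 : mass (m + 1) π₃ = ∑ k ∈ range (m + 1), π₃ k := by
        unfold mass; rw [Finset.sum_range_succ, h3t, add_zero]
      linarith
    · -- moments
      show ∑ k ∈ range (m + 1), (k : ℝ) * π₁ (k + 1) + ∑ k ∈ range (m + 1), (k : ℝ) * (π₂ k - f k)
          + ∑ k ∈ range (m + 1), (k : ℝ) * (π₃ k - f (m + 1 - k)) =
          m * ∑ k ∈ range (m + 1), π₁ (k + 1)
      simp only [mul_sub, Finset.sum_sub_distrib]
      rw [hF]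
      have e1 : moment (m + 1) π₁ = ∑ k ∈ range (m + 1), (k : ℝ) * π₁ (k + 1) +
          ∑ k ∈ range (m + 1), π₁ (k + 1) := by
        unfold moment
        rw [Finset.sum_range_succ', Nat.cast_zero, zero_mul, add_zero, ← Finset.sum_add_distrib]
        refine Finset.sum_congr rfl fun k _ => ?_
        push_cast; ring
      have e2 : moment (m + 1) π₂ = ∑ k ∈ range (m + 1), (k : ℝ) * π₂ k := by
        unfold moment; rw [Finset.sum_range_succ, h2t, mul_zero, add_zero]
      have e3 : moment (m + 1) π₃ = ∑ k ∈ range (m + 1), (k : ℝ) * π₃ k := by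
        unfold moment; rw [Finset.sum_range_succ, h3t, mul_zero, add_zero]
      have e4 : mass (m + 1) π₁ = ∑ k ∈ range (m + 1), π₁ (k + 1) + π₁ 0 := by
        unfold mass; rw [Finset.sum_range_succ']
      have hmom' := hmom
      push_cast at hmom'
      nlinarith [e1, e2, e3, e4, hmom']
  obtain ⟨w', hw0, hws, hw1, hw2, hw3⟩ := IH ρ₁ ρ₂ ρ₃ hadm
  -- the coupling one level up
  have hw'z : ∀ a b c, m < a + b + c → w' a b c = 0 := by
    intro a b c habc; by_contra hne; have := hws a b c hne; omega
  refine ⟨fun a b c => if a = 0 then (if b + c = m + 1 then f b else 0) else w' (a - 1) b c,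
    fun a b c => ?_, fun a b c hne => ?_, fun a => ?_, fun b => ?_, fun c => ?_⟩
  · dsimp only; split_ifs
    · exact hf0 b
    · exact le_rfl
    · exact hw0 _ _ _
  · dsimp only at hne
    split_ifs at hne with ha hbc
    · omega
    · exact absurd rfl hne
    · have := hws _ _ _ hne; omega
  · -- first marginal
    dsimp only
    rcases Nat.eq_zero_or_pos a with ha | ha
    · subst ha
      simp only [if_true]
      have : ∀ b ∈ range (m + 1 + 1),
          (∑ c ∈ range (m + 1 + 1), if b + c = m + 1 then f b else (0 : ℝ)) = f b := by
        intro b hb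
        rw [Finset.mem_range] at hb
        rw [Finset.sum_eq_single (m + 1 - b)]
        · rw [if_pos (by omega)]
        · intro c _ hc; exact if_neg (by omega)
        · intro hc; exact absurd (Finset.mem_range.2 (by omega)) hc
      rw [Finset.sum_congr rfl this, hfs]
    · simp only [if_neg (show a ≠ 0 by omega)]
      rw [show π₁ a = ρ₁ (a - 1) by simp [hρ₁, Nat.sub_add_cancel ha], ← hw1 (a - 1),
        Finset.sum_range_succ, Finset.sum_eq_zero (fun c _ => hw'z _ _ _ (by omega)), add_zero]
      refine Finset.sum_congr rfl fun b _ => ?_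
      rw [Finset.sum_range_succ, hw'z _ _ _ (by omega), add_zero]
  · -- second marginal
    dsimp only
    rw [Finset.sum_range_succ']
    simp only [if_true, Nat.add_sub_cancel, if_neg (Nat.succ_ne_zero _)]
    have e1 : (∑ c ∈ range (m + 1 + 1), if b + c = m + 1 then f b else (0 : ℝ)) = f b := by
      rcases Nat.lt_or_ge (m + 1) b with hb | hb
      · rw [hftop b (by omega)]
        exact Finset.sum_eq_zero fun c _ => by simp
      · rw [Finset.sum_eq_single (m + 1 - b)]
        · rw [if_pos (by omega)]
        · intro c _ hc; exact if_neg (by omega)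
        · intro hc; exact absurd (Finset.mem_range.2 (by omega)) hc
    have e2 : ∑ a ∈ range (m + 1), ∑ c ∈ range (m + 1 + 1), w' a b c = ρ₂ b := by
      rw [← hw2 b]
      refine Finset.sum_congr rfl fun a _ => ?_
      rw [Finset.sum_range_succ, hw'z _ _ _ (by omega), add_zero]
    rw [e1, e2, hρ₂]
    ring
  · -- third marginal
    dsimp only
    rw [Finset.sum_range_succ']
    simp only [if_true, Nat.add_sub_cancel, if_neg (Nat.succ_ne_zero _)]
    have e1 : (∑ b ∈ range (m + 1 + 1), if b + c = m + 1 then f b else (0 : ℝ)) = f (m + 1 - c) := by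
      rcases Nat.lt_or_ge (m + 1) c with hc | hc
      · rw [show m + 1 - c = 0 by omega, hf00]
        exact Finset.sum_eq_zero fun b _ => if_neg (by omega)
      · rw [Finset.sum_eq_single (m + 1 - c)]
        · rw [if_pos (by omega)]
        · intro b _ hb; exact if_neg (by omega)
        · intro hb; exact absurd (Finset.mem_range.2 (by omega)) hb
    have e2 : ∑ a ∈ range (m + 1), ∑ b ∈ range (m + 1 + 1), w' a b c = ρ₃ c := by
      rw [← hw3 c]
      refine Finset.sum_congr rfl fun a _ => ?_
      rw [Finset.sum_range_succ, hw'z _ _ _ (by omega), add_zero]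
    rw [e1, e2, hρ₃]
    ring

end Literature.Combinatorics.Additive.Pebody
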